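import Summits.NavierStokesRegularity.FunctionalMining.NoGo.StrainTransportPointwise
import HarnessLib

/-!
(Part 2/3 — the theorem and its corollaries; part 1 = `NoGo/StrainTransportPointwise.lean`, part 3 = `NoGo/PalinstrophyStrainLadder.lean`; split by the prove seat for the 400-line cap, text verbatim.)
# Functional mining, no-go side: the palinstrophy transport factor in strain currency — `|N(v)| ≤ √6 · sup|S|_F · 𝒫(v)` on `T³` (PROVED)

Search for candidate a priori estimates; no regularity claim.

NS FUNCTIONAL MINING cell (`pub-nsfunc`), no-go seat, WINDOW analysis (seat file `WINDOW.md` §1,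
"transport factor"). The tree's Doering–Gibbon `N = 2` rung
(`Torus.abs_integral_inner_convect_bilaplacian_le`, any `d`) bounds the palinstrophy production
`N(v) = −∫⟪(v·∇)v, Δ²v⟫` by `3 · M · 𝒫(v)` when the FULL velocity gradient is bounded in Frobenius
norm, `Σᵢ‖∂ᵢv(x)‖² ≤ M²`. This file proves the sharper, strain-only version in `d = 3`:

* `abs_palinstrophyProduction_le_sqrt_six_mul_strainSup` — for smooth divergence-free `v` on `T³`
  with `|S(x)|_F² = Σᵢⱼ ((∂ⱼvᵢ + ∂ᵢvⱼ)/2)² ≤ M²` pointwise (`M ≥ 0`):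
  `|N(v)| ≤ √6 · M · 𝒫(v)`.

Only the STRAIN enters (the antisymmetric part of `∇v` drops out of both surviving Leibniz pieces
because the Hessians `∂ᵢ∂ₘv` are symmetric in `(i, m)` and `Δv ⊗ Δv` is symmetric), and the
trace-free structure (`tr S = div v = 0`) replaces the two Cauchy–Schwarz constants `1, 1` of the
printed proof by the deviatoric ones `√(2/3), √(2/3)`: with `a = Δv`, `H^{(j)} = ∇²vⱼ`,
`2|Σⱼ aⱼ ⟨S, H^{(j)}⟩| ≤ 2|S|_F |a| (Σⱼ |H^{(j)}_0|²)^{1/2}`, `|H_0|² = |H|² − (tr H)²/3`,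
`Σⱼ (tr H^{(j)})² = |Δv|²`, `∫Σⱼ|H^{(j)}|² = 𝒫` (torus), so `2|∫P₂| ≤ 2√(2/3) M 𝒫`; and
`|aᵀSa| ≤ √(2/3)|S|_F|a|²`, so `|∫P₃| ≤ √(2/3) M 𝒫`; total `3√(2/3) = √6`.

Corollaries: `abs_integral_inner_convect_bilaplacian_le_sqrt_six` (the tree's statement with `3`
replaced by `√6` in `d = 3`, since `|S|_F ≤ |∇v|_F` pointwise),
`palinstrophyProduction_le_sqrt_six_of_gradSup` (the dictionary row `PalinstrophyProductionSupBound`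
with constant `√6 < 3`), the typed static row `PalinstrophyStrainSupBound C` with
`palinstrophyStrainSupBound_sqrt_six`, its dynamic reading along classical solutions
`derivWithin_torusPalinstrophy_le_strainSup` (`d𝒫/dt ≤ 2√6·M·𝒫 − 2νD₃` whenever `|S(·,t)|_F ≤ M`),
and the DICTIONARY CONTRAST `strainSup_controls_production_vorticitySup_does_not`: at the palinstrophy
level the sup of the STRAIN controls production (constant `√6`, this file) while the sup of the
VORTICITY does not at any constant (the tree's N6, `LogDoor.palinstrophySupRateFails_fin3`, whose witness is a
pure-strain core with vanishing vorticity — the `L^∞` failure of Calderón–Zygmund, and nothing else,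
separates the two rows). Context: a deformation-tensor (strain) version of the Beale–Kato–Majda
criterion is classical (G. Ponce, Commun. Math. Phys. 98 (1985) 349–353, doi:10.1007/BF01205787;
constants unspecified); the present file is only the explicit-constant `H²` step on `T³`.

LADDER CONSTANT (last section): the tree's K1-Q0(𝒫) ladder law (`palinstrophyLadderLaw`,
`PalinstrophyLadderProofs.lean`) feeds its target L1 with the constant `3`; re-running the real
inequality L4 and the assembly with the production constant as a parameter (`ladderConstOf`,
`ladderConstOf_identity`, `ladderRealIneq_param`, `PalinstrophyProductionSupBoundWith`,
`palinstrophySaturatingLaw_of_productionConst` — verbatim copies of the tree proofs with `3 ↦ C`) and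
L1 at `√6` gives `palinstrophySaturatingLaw_strain`: the saturating law
`d𝒫/dt ≤ κ ν^{-5/3}(2ℰ)𝒫^{4/3}` for every `κ ≥ κ_S := κ(2√6·√2/π) = (2/3)^{4/3}·κ_A`
(`palinstrophyLadderConstStrain_eq`; `(2/3)^{4/3} < 0.583`, `palinstrophyLadderConstStrain_lt`;
numerically `κ_S ≈ 0.4447` vs `κ_A ≈ 0.7635`).

Honest framing. This is an elementary sharpening of a textbook estimate (Doering–Gibbon 1995, §6.2,
(6.2.25) at `N = 2`); it is [ours, internal, unreviewed] as a statement with this constant — no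
printed source states `√6`, and none is claimed. It asserts nothing about Navier–Stokes regularity:
it is one constant in the cell's log-window bookkeeping (`WINDOW.md`: the best constant `c_F` in
`|N| ≤ c_F · sup|S|_F · 𝒫` over smooth divergence-free fields on `T³` lies in `[√2, √6]`; the lower
value `√2` is approached — at paper level, first-order (passive) bookkeeping only — by single-scale
packets with wavevector on the compressive axis and polarisation on the intermediate axis of a
locally uniform trace-free strain with eigenvalues `(1, 0, −1)/√2`; the optimal `c_F` is not claimed).

## References

* C. R. Doering, J. D. Gibbon, *Applied Analysis of the Navier–Stokes Equations*, CUP 1995, §6.2,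
  proof of Thm 6.1, Step 2, eq. (6.2.25) (`N = 2`). [DoeringGibbon1995]
* Tree: `Literature/Analysis/FluidPDE/TorusPalinstrophyLadder.lean`
  (`Torus.abs_integral_inner_convect_bilaplacian_le`, constant `3`, any `d`);
  `Summits/NavierStokesRegularity/FunctionalMining/PalinstrophyLadderProofs.lean` (`ladderConst_identity`,
  `ladderRealIneq_holds`, `palinstrophyLadderLaw`; the parametric copies below follow them line by line).
-/

noncomputable section

open MeasureTheory Set Finset Real
open scoped InnerProductSpace RealInnerProductSpace

namespace Summit.NavierStokesRegularity.FunctionalMining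

open Literature.Analysis.FunctionSpaces Literature.Analysis.FluidPDE

variable {d : Type*} [Fintype d] [DecidableEq d]

/-! ## The Laplacian of the inertial term (Leibniz twice; as in the tree's ladder file) -/

/-- `Δ((u·∇)u)(x) = ∑ₘ (u·∇)∂ₘ∂ₘu (x) + 2 ∑ₘ (∂ₘu·∇)∂ₘu (x) + (Δu·∇)u (x)` (the tree's private
`laplacian_convect_self_apply`, re-derived). [folklore] -/
theorem laplacian_convect_self_apply' {u : UnitAddTorus d → EuclideanSpace ℝ d}
    (hu : Torus.IsSmooth u) (x : UnitAddTorus d) :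
    Torus.laplacian (Torus.convect u u) x =
      ∑ m, Torus.convect u (Torus.partialDeriv m (Torus.partialDeriv m u)) x +
        (2 : ℝ) • ∑ m, Torus.convect (Torus.partialDeriv m u) (Torus.partialDeriv m u) x +
        Torus.convect (Torus.laplacian u) u x := by
  have hB : Torus.IsSmooth (Torus.convect u u) := hu.convect hu
  have hD : ∀ m, Torus.IsSmooth (Torus.partialDeriv m u) := fun m => hu.partialDeriv m
  have h1 : ∀ m, Torus.partialDeriv m (Torus.convect u u) =
      Torus.convect u (Torus.partialDeriv m u) + Torus.convect (Torus.partialDeriv m u) u := by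
    intro m; funext y
    rw [Pi.add_apply]
    exact Torus.partialDeriv_convect_eq_add_convect hu hu m y
  have h2 : ∀ m, Torus.partialDeriv m (Torus.partialDeriv m (Torus.convect u u)) x =
      Torus.convect u (Torus.partialDeriv m (Torus.partialDeriv m u)) x +
        (2 : ℝ) • Torus.convect (Torus.partialDeriv m u) (Torus.partialDeriv m u) x +
        Torus.convect (Torus.partialDeriv m (Torus.partialDeriv m u)) u x := by
    intro m
    have hs1 : Torus.IsSmooth (Torus.convect u (Torus.partialDeriv m u)) := hu.convect (hD m)
    have hs2 : Torus.IsSmooth (Torus.convect (Torus.partialDeriv m u) u) := (hD m).convect hu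
    rw [h1 m, Torus.partialDeriv_add (hs1.isContDiff (by simp)) (hs2.isContDiff (by simp)),
      Pi.add_apply, Torus.partialDeriv_convect_eq_add_convect hu (hD m) m x,
      Torus.partialDeriv_convect_eq_add_convect (hD m) hu m x, two_smul]
    abel
  rw [Torus.laplacian_eq_sum_partialDeriv_partialDeriv hB x]
  simp_rw [h2]
  rw [Finset.sum_add_distrib, Finset.sum_add_distrib, Finset.smul_sum]
  congr 1
  simp only [Torus.convect]
  rw [← map_sum]
  congr 1
  rw [Torus.laplacian_eq_sum_partialDeriv_partialDeriv hu x]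

/-- `∑ₘ (u·∇)∂ₘ∂ₘu (x) = (u·∇)Δu (x)` (the tree's private `sum_convect_partialDeriv_partialDeriv_eq`,
re-derived). [folklore] -/
theorem sum_convect_partialDeriv_partialDeriv_eq' {u : UnitAddTorus d → EuclideanSpace ℝ d}
    (hu : Torus.IsSmooth u) (x : UnitAddTorus d) :
    ∑ m, Torus.convect u (Torus.partialDeriv m (Torus.partialDeriv m u)) x =
      Torus.convect u (Torus.laplacian u) x := by
  have hDD : ∀ m, Torus.IsSmooth (Torus.partialDeriv m (Torus.partialDeriv m u)) :=
    fun m => (hu.partialDeriv m).partialDeriv m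
  have hΔfun : Torus.laplacian u = fun y => ∑ m, Torus.partialDeriv m (Torus.partialDeriv m u) y := by
    funext y; exact Torus.laplacian_eq_sum_partialDeriv_partialDeriv hu y
  simp only [Torus.convect]
  rw [Torus.fderiv_apply_eq_sum_partialDeriv (hu.laplacian.isContDiff (by simp)) x (u x)]
  simp_rw [Torus.fderiv_apply_eq_sum_partialDeriv ((hDD _).isContDiff (by simp)) x (u x)]
  rw [Finset.sum_comm]
  refine Finset.sum_congr rfl fun i _ => ?_
  rw [← Finset.smul_sum]
  congr 1
  rw [hΔfun, Torus.partialDeriv_finset_sum _ (fun m _ => (hDD m).isContDiff (by simp))]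

/-! ## The theorem -/

/-- **Palinstrophy production against the sup of the STRAIN, constant `√6`.** For a smooth
divergence-free `v` on `T³` with `|S(x)|_F² = Σᵢⱼ((∂ⱼvᵢ + ∂ᵢvⱼ)/2)² ≤ M²` for all `x` (`M ≥ 0`):
`|N(v)| ≤ √6 · M · 𝒫(v)` (`N = palinstrophyProduction`, `𝒫 = torusPalinstrophy = ‖Δv‖₂²`).
Green, Leibniz, the transport piece vanishes (`div v = 0`), the two surviving pieces are bounded
pointwise by `abs_inner_convect_laplacian_le` / `two_mul_abs_sum_inner_convect_partialDeriv_le`, and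
`∫Σ‖∂ᵢ∂ₘv‖² = ∫‖Δv‖²` on the torus. Search for candidate a priori estimates; no regularity claim.
[ours — sharpening of DoeringGibbon1995 (6.2.25), N = 2; internal, unreviewed] -/
theorem abs_palinstrophyProduction_le_sqrt_six_mul_strainSup (hd : Fintype.card d = 3)
    {v : UnitAddTorus d → EuclideanSpace ℝ d} (hv : Torus.IsSmooth v) (hdiv : Torus.IsDivFree v)
    {M : ℝ} (hM : 0 ≤ M)
    (hS : ∀ x, ∑ i, ∑ j, ((Torus.partialDeriv j v x i + Torus.partialDeriv i v x j) / 2) ^ 2 ≤ M ^ 2) :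
    |palinstrophyProduction v| ≤ Real.sqrt 6 * M * torusPalinstrophy v := by
  have hB : Torus.IsSmooth (Torus.convect v v) := hv.convect hv
  have hΔ : Torus.IsSmooth (Torus.laplacian v) := hv.laplacian
  have hD : ∀ m, Torus.IsSmooth (Torus.partialDeriv m v) := fun m => hv.partialDeriv m
  have hDD : ∀ i m, Torus.IsSmooth (Torus.partialDeriv i (Torus.partialDeriv m v)) :=
    fun i m => (hD m).partialDeriv i
  -- ### Green
  have hN : palinstrophyProduction v =
      -∫ x, ⟪Torus.laplacian (Torus.convect v v) x, Torus.laplacian v x⟫_ℝ := by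
    rw [palinstrophyProduction, Torus.integral_inner_laplacian_comm hB hΔ]
  -- the three pieces of `⟪ΔB, Δv⟫`
  set P1 : UnitAddTorus d → ℝ := fun x =>
    ⟪Torus.convect v (Torus.laplacian v) x, Torus.laplacian v x⟫_ℝ with hP1
  set P2 : UnitAddTorus d → ℝ := fun x =>
    ∑ m, ⟪Torus.convect (Torus.partialDeriv m v) (Torus.partialDeriv m v) x, Torus.laplacian v x⟫_ℝ
    with hP2
  set P3 : UnitAddTorus d → ℝ := fun x =>
    ⟪Torus.convect (Torus.laplacian v) v x, Torus.laplacian v x⟫_ℝ with hP3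
  have hsplit : ∀ x, ⟪Torus.laplacian (Torus.convect v v) x, Torus.laplacian v x⟫_ℝ =
      P1 x + 2 * P2 x + P3 x := by
    intro x
    rw [laplacian_convect_self_apply' hv x, sum_convect_partialDeriv_partialDeriv_eq' hv x,
      inner_add_left, inner_add_left, hP1, hP2, hP3]
    simp only
    rw [real_inner_smul_left, sum_inner]
  have hc1 : Continuous P1 := (hv.convect hΔ).continuous.inner hΔ.continuous
  have hc2 : Continuous P2 :=
    continuous_finsetSum _ fun m _ => ((hD m).convect (hD m)).continuous.inner hΔ.continuous
  have hc3 : Continuous P3 := (hΔ.convect hv).continuous.inner hΔ.continuous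
  have i1 : Integrable (fun x => P1 x + 2 * P2 x) :=
    (hc1.add (continuous_const.mul hc2)).integrable_unitAddTorus
  have i2 : Integrable P3 := hc3.integrable_unitAddTorus
  have i3 : Integrable P1 := hc1.integrable_unitAddTorus
  have i4 : Integrable (fun x => 2 * P2 x) := (continuous_const.mul hc2).integrable_unitAddTorus
  have hI : ∫ x, ⟪Torus.laplacian (Torus.convect v v) x, Torus.laplacian v x⟫_ℝ =
      (∫ x, P1 x) + 2 * (∫ x, P2 x) + ∫ x, P3 x := by
    rw [integral_congr_ae (Filter.Eventually.of_forall hsplit)]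
    change ∫ x, ((P1 x + 2 * P2 x) + P3 x) = _
    rw [integral_add i1 i2, integral_add i3 i4, integral_const_mul]
  -- ### the transport term vanishes
  have hP1z : ∫ x, P1 x = 0 := Torus.integral_inner_convect_self_right_eq_zero hv hdiv hΔ
  -- ### pointwise bounds
  set na : UnitAddTorus d → ℝ := fun x => ‖Torus.laplacian v x‖ ^ 2 with hna
  set G2 : UnitAddTorus d → ℝ := fun x =>
    ∑ m, ∑ i, ‖Torus.partialDeriv i (Torus.partialDeriv m v) x‖ ^ 2 with hG2
  have hP3le : ∀ x, |P3 x| ≤ Real.sqrt 6 / 3 * M * na x := fun x =>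
    abs_inner_convect_laplacian_le hd hv hdiv hM x (hS x)
  have hP2le : ∀ x, |P2 x| ≤ M / 2 * (Real.sqrt 6 / 3 * na x + Real.sqrt 6 / 2 * (G2 x - na x / 3)) := by
    intro x
    have h := two_mul_abs_sum_inner_convect_partialDeriv_le hd hv hdiv hM x (hS x)
    simp only [hP2, hna, hG2]
    linarith
  -- ### integrate
  have hnac : Continuous na := (hΔ.continuous.norm).pow 2
  have hG2c : Continuous G2 :=
    continuous_finsetSum _ fun m _ => continuous_finsetSum _ fun i _ => ((hDD i m).continuous.norm).pow 2
  have hIna : ∫ x, na x = torusPalinstrophy v := rfl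
  have hIG2 : ∫ x, G2 x = torusPalinstrophy v := by
    rw [torusPalinstrophy, ← Torus.integral_sum_sum_norm_partialDeriv_partialDeriv_sq_eq hv]
  have hI3 : |∫ x, P3 x| ≤ Real.sqrt 6 / 3 * M * torusPalinstrophy v := by
    calc |∫ x, P3 x| ≤ ∫ x, |P3 x| := abs_integral_le_integral_abs
      _ ≤ ∫ x, Real.sqrt 6 / 3 * M * na x :=
          integral_mono i2.abs (hnac.integrable_unitAddTorus.const_mul _) hP3le
      _ = Real.sqrt 6 / 3 * M * torusPalinstrophy v := by rw [integral_const_mul, hIna]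
  have hI2 : |∫ x, P2 x| ≤ Real.sqrt 6 / 3 * M * torusPalinstrophy v := by
    have ib : Integrable (fun x => M / 2 * (Real.sqrt 6 / 3 * na x + Real.sqrt 6 / 2 * (G2 x - na x / 3))) :=
      (continuous_const.mul ((continuous_const.mul hnac).add
        (continuous_const.mul (hG2c.sub (hnac.div_const _))))).integrable_unitAddTorus
    have hval : ∫ x, M / 2 * (Real.sqrt 6 / 3 * na x + Real.sqrt 6 / 2 * (G2 x - na x / 3)) =
        Real.sqrt 6 / 3 * M * torusPalinstrophy v := by
      have ina : Integrable na := hnac.integrable_unitAddTorus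
      have iG2 : Integrable G2 := hG2c.integrable_unitAddTorus
      have iA : Integrable (fun x => Real.sqrt 6 / 3 * na x) := ina.const_mul _
      have iB : Integrable (fun x => Real.sqrt 6 / 2 * (G2 x - na x / 3)) :=
        (iG2.sub (ina.div_const 3)).const_mul _
      have e1 : ∫ x, (Real.sqrt 6 / 3 * na x + Real.sqrt 6 / 2 * (G2 x - na x / 3)) =
          (∫ x, Real.sqrt 6 / 3 * na x) + ∫ x, Real.sqrt 6 / 2 * (G2 x - na x / 3) :=
        integral_add iA iB
      have e2 : ∫ x, (G2 x - na x / 3) = (∫ x, G2 x) - ∫ x, na x / 3 :=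
        integral_sub iG2 (ina.div_const 3)
      rw [integral_const_mul, e1, integral_const_mul, integral_const_mul, e2, integral_div, hIna,
        hIG2]
      ring
    calc |∫ x, P2 x| ≤ ∫ x, |P2 x| := abs_integral_le_integral_abs
      _ ≤ ∫ x, M / 2 * (Real.sqrt 6 / 3 * na x + Real.sqrt 6 / 2 * (G2 x - na x / 3)) :=
          integral_mono hc2.integrable_unitAddTorus.abs ib hP2le
      _ = Real.sqrt 6 / 3 * M * torusPalinstrophy v := hval
  -- ### assembly
  rw [hN, hI, hP1z, zero_add, abs_neg, abs_le]
  have h2 := abs_le.1 hI2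
  have h3 := abs_le.1 hI3
  constructor <;> nlinarith [h2.1, h2.2, h3.1, h3.2]

/-! ## Corollaries -/

/-- **The tree's Doering–Gibbon statement with `3` replaced by `√6` (in `d = 3`)**: under the FULL
gradient bound `Σᵢ‖∂ᵢv(x)‖² ≤ M²`, `|∫⟪(v·∇)v, Δ²v⟫| ≤ √6 · M · ∫‖Δv‖²` (since `|S|_F ≤ |∇v|_F`
pointwise). Search for candidate a priori estimates; no regularity claim. [ours; internal] -/
theorem abs_integral_inner_convect_bilaplacian_le_sqrt_six (hd : Fintype.card d = 3)
    {v : UnitAddTorus d → EuclideanSpace ℝ d} (hv : Torus.IsSmooth v) (hdiv : Torus.IsDivFree v)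
    {M : ℝ} (hM : 0 ≤ M) (hgrad : ∀ x, ∑ i, ‖Torus.partialDeriv i v x‖ ^ 2 ≤ M ^ 2) :
    |∫ x, ⟪Torus.convect v v x, Torus.laplacian (Torus.laplacian v) x⟫_ℝ| ≤
      Real.sqrt 6 * M * ∫ x, ‖Torus.laplacian v x‖ ^ 2 := by
  have hS : ∀ x, ∑ i, ∑ j, ((Torus.partialDeriv j v x i + Torus.partialDeriv i v x j) / 2) ^ 2 ≤
      M ^ 2 := by
    intro x
    refine (StrainTransport.sum_symm_sq_le (fun i j => Torus.partialDeriv i v x j)).trans ?_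
    refine le_of_eq_of_le ?_ (hgrad x)
    refine Finset.sum_congr rfl fun i _ => ?_
    rw [EuclideanSpace.norm_sq_eq]
    exact Finset.sum_congr rfl fun j _ => by rw [Real.norm_eq_abs, sq_abs]
  have h := abs_palinstrophyProduction_le_sqrt_six_mul_strainSup hd hv hdiv hM hS
  rw [palinstrophyProduction, abs_neg] at h
  exact h

/-- **The dictionary row `PalinstrophyProductionSupBound` with constant `√6 < 3`**: for smooth
divergence-free `v` on `T³` with `Σᵢ‖∂ᵢv(x)‖² ≤ M²` pointwise, `N(v) ≤ √6 · M · 𝒫(v)`.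
Search for candidate a priori estimates; no regularity claim. [ours; internal] -/
theorem palinstrophyProduction_le_sqrt_six_of_gradSup (hd : Fintype.card d = 3)
    {v : UnitAddTorus d → EuclideanSpace ℝ d} (hv : Torus.IsSmooth v) (hdiv : Torus.IsDivFree v)
    {M : ℝ} (hM : 0 ≤ M) (hgrad : ∀ x, ∑ i, ‖Torus.partialDeriv i v x‖ ^ 2 ≤ M ^ 2) :
    palinstrophyProduction v ≤ Real.sqrt 6 * M * torusPalinstrophy v := by
  have h := abs_integral_inner_convect_bilaplacian_le_sqrt_six hd hv hdiv hM hgrad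
  rw [palinstrophyProduction, torusPalinstrophy]
  have h' := (abs_le.1 h).1
  linarith

/-- **Typed static row (strain currency)**: `N(v) ≤ C · M · 𝒫(v)` for every smooth divergence-free
`v` on `T³` and every `M ≥ 0` with `|S(x)|_F² ≤ M²` pointwise. Compare the tree's
`PalinstrophySupRateBound C` (same row with the VORTICITY majorant `|ω(x)|² ≤ M²`), which FAILS for
every `C` (N6). Search for candidate a priori estimates; no regularity claim — nothing is asserted by
the definition. -/
def PalinstrophyStrainSupBound (C : ℝ) : Prop :=
  Fintype.card d = 3 → ∀ v : UnitAddTorus d → EuclideanSpace ℝ d, Torus.IsSmooth v →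
    Torus.IsDivFree v → ∀ M : ℝ, 0 ≤ M →
      (∀ x, ∑ i, ∑ j, ((Torus.partialDeriv j v x i + Torus.partialDeriv i v x j) / 2) ^ 2 ≤ M ^ 2) →
        palinstrophyProduction v ≤ C * M * torusPalinstrophy v

/-- The strain row HOLDS with `C = √6`. Search for candidate a priori estimates; no regularity claim.
[ours; internal] -/
theorem palinstrophyStrainSupBound_sqrt_six : PalinstrophyStrainSupBound (d := d) (Real.sqrt 6) :=
  fun hd _ hv hdiv _ hM hS =>
    (abs_le.1 (abs_palinstrophyProduction_le_sqrt_six_mul_strainSup hd hv hdiv hM hS)).2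

/-- The strain row is monotone in the constant. [folklore] -/
theorem PalinstrophyStrainSupBound.mono {C C' : ℝ} (h : PalinstrophyStrainSupBound (d := d) C)
    (hCC' : C ≤ C') : PalinstrophyStrainSupBound (d := d) C' := by
  intro hd v hv hdiv M hM hS
  have hP : 0 ≤ torusPalinstrophy v := torusPalinstrophy_nonneg _
  have h1 := h hd v hv hdiv M hM hS
  nlinarith [mul_nonneg (mul_nonneg (sub_nonneg.2 hCC') hM) hP]

/-- **Dynamic reading (the `H²` balance + the strain row).** Along a classical solution of unforced
Navier–Stokes on `T³ × [a, b]` (`a < b`), at every `t ∈ [a, b]` at which `|S(x, t)|_F² ≤ M²` for all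
`x` (`M ≥ 0`): `d𝒫/dt ≤ 2√6 · M · 𝒫(t) − 2ν D₃(t)` (one-sided derivative within `[a, b]`). Search for
candidate a priori estimates; no regularity claim. [ours; internal] -/
theorem derivWithin_torusPalinstrophy_le_strainSup (hd : Fintype.card d = 3) {a b ν : ℝ}
    {u : ℝ → UnitAddTorus d → EuclideanSpace ℝ d} {p : ℝ → UnitAddTorus d → ℝ}
    (hsol : Torus.IsClassicalNSSolutionOn (Icc a b) ν 0 u p) (hab : a < b) {t : ℝ}
    (ht : t ∈ Icc a b) {M : ℝ} (hM : 0 ≤ M)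
    (hS : ∀ x, ∑ i, ∑ j, ((Torus.partialDeriv j (u t) x i + Torus.partialDeriv i (u t) x j) / 2) ^ 2 ≤
      M ^ 2) :
    derivWithin (fun s => torusPalinstrophy (u s)) (Icc a b) t ≤
      2 * Real.sqrt 6 * M * torusPalinstrophy (u t) - 2 * ν * palinstrophyDissipation (u t) := by
  have hder := torusPalinstrophy_hasDerivWithinAt hsol hab ht
  rw [hder.derivWithin (uniqueDiffOn_Icc hab t ht)]
  have hsm : Torus.IsSmooth (u t) := hsol.smooth_velocity.isSmooth_slice ht
  have hdf : Torus.IsDivFree (u t) := hsol.divFree t ht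
  have h := (abs_le.1 (abs_palinstrophyProduction_le_sqrt_six_mul_strainSup hd hsm hdf hM hS)).2
  linarith

/-- **DICTIONARY CONTRAST (strain vs vorticity at the palinstrophy level).** On `T³` the strain row
holds with constant `√6` while the vorticity row `PalinstrophySupRateBound C` fails for every `C`
(the tree's kernel-checked N6, `LogDoor.palinstrophySupRateFails_fin3`). Search for candidate a priori
estimates; no regularity claim. [ours; internal] -/
theorem strainSup_controls_production_vorticitySup_does_not :
    PalinstrophyStrainSupBound (d := Fin 3) (Real.sqrt 6) ∧ PalinstrophySupRateFails (d := Fin 3) :=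
  ⟨palinstrophyStrainSupBound_sqrt_six, LogDoor.palinstrophySupRateFails_fin3⟩

/-- `√6 < 3`: the constant is a strict improvement of the tree's `3`. [folklore] -/
theorem sqrt_six_lt_three : Real.sqrt 6 < 3 := by
  rw [show (3 : ℝ) = Real.sqrt 9 by rw [show (9 : ℝ) = 3 ^ 2 by norm_num, Real.sqrt_sq (by norm_num)]]
  exact Real.sqrt_lt_sqrt (by norm_num) (by norm_num)

end Summit.NavierStokesRegularity.FunctionalMining

end
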